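import Mathlib
import Summits.PneNP.PneNP.Theses.RamseyUncertifiable
import Literature.Computability.MetaComplexity.ProofSystems
import Literature.Computability.MetaComplexity.ProofSystemsProofs

/-!
# Crux-triage r2 (triager 2) — certificates for the COSTUME check of card `optimality-cut`

Self-contained (the published `Cruxes/RamseyNotNP/SketchIdeator5.lean` is not an importable farm
module): Part A re-verifies the card's `First lemma:` block verbatim (definitions `ramseyLang`,
`Hard`, `Opt`, `FCT` and the lemmas `ramseyNotNP_of_hard_opt`, `hard_of_ramseyNotNP`,
`opt_of_isPolyBounded`, `fct_of_opt`, `fct_iff_or` — copied from the card's sketch); Part B are the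
triage certificates, kernel-checked facts ABOUT those lemmas:

* `fct_iff_hard_imp` : the "feasible-certification thesis" `FCT Q` is LITERALLY the implication
  `Hard Q → RamseyNotNP`; hence the card's `ramseyNotNP_iff_hard_of_fct` ("under the thesis the
  crux IS one lower bound") is the propositional tautology `(H → X) → (X → H) → (X ↔ H)`.
* `stubs_iff_crux_and_opt` : the stub set of the proposed line, `Hard Q ∧ Opt Q`, is equivalent to
  `RamseyNotNP ∧ Opt Q` — the crux itself plus the optimality of `Q`; nothing of X is cut away.
* `generic_cut`, `generic_stubs_iff` : the cut holds for EVERY language `L` and every proof system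
  `Q` for `L` with the same three-line proof — no property of Ramsey graphs enters the lever.
* `opt_iff_split` : `Opt Q ↔ (¬X → IsPolyBounded Q) ∧ (X → Opt Q)`: beyond `FCT` (= `Hard → X`) the
  only content of `Opt Q` is "in the X-world, `Q` is an optimal Ramsey certifier" — the open
  existence-of-optimal-proof-systems problem for RAMSEY₂, relocated into a stub.
-/

namespace Summit.PneNP.PneNP.Cruxes.RamseyNotNP.TriageR2K2

open Literature.Computability.Complexity Literature.Computability.Complexity.Nondeterministic
open Literature.Computability.MetaComplexity
open Summit.PneNP.PneNP.Theses.RamseyUncertifiable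

/-! ## Part A — the card's first-lemma block, re-verified verbatim -/

/-- RAMSEY₂ as a language of adjacency codes (the crux's set-builder, verbatim). -/
def ramseyLang : Language Bool :=
  encodingGraph.toLanguage {p : Σ n, SimpleGraph (Fin n) |
    p.2.CliqueFree (Nat.clog 2 (p.1 ^ 2)) ∧ p.2ᶜ.CliqueFree (Nat.clog 2 (p.1 ^ 2))}

theorem ramseyNotNP_iff : RamseyNotNP ↔ ramseyLang ∉ NP := Iff.rfl

def Hard (Q : List Bool → List Bool → Bool) : Prop := ¬ IsPolyBounded Q

def Opt (Q : List Bool → List Bool → Bool) : Prop :=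
  ∀ W, IsProofSystemFor W ramseyLang → Simulates Q W

def FCT (Q : List Bool → List Bool → Bool) : Prop := ramseyLang ∈ NP → IsPolyBounded Q

theorem ramseyNotNP_of_hard_opt {Q : List Bool → List Bool → Bool}
    (hQ : IsProofSystemFor Q ramseyLang) (hH : Hard Q) (hO : Opt Q) : RamseyNotNP := by
  intro hNP
  obtain ⟨W, hW, hWb⟩ := (hasPolyBoundedProofSystem_iff_mem_NP_holds (L := ramseyLang)).2 hNP
  exact hH (IsPolyBounded.of_simulates_holds (hO W hW) hWb hQ hW)

theorem hard_of_ramseyNotNP (hX : RamseyNotNP) {Q : List Bool → List Bool → Bool}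
    (hQ : IsProofSystemFor Q ramseyLang) : Hard Q :=
  fun hb => hX ((hasPolyBoundedProofSystem_iff_mem_NP_holds (L := ramseyLang)).1 ⟨Q, hQ, hb⟩)

private theorem eval_mono (r : Polynomial ℕ) {a b : ℕ} (hab : a ≤ b) : r.eval a ≤ r.eval b := by
  rw [Polynomial.eval_eq_sum_range, Polynomial.eval_eq_sum_range]
  exact Finset.sum_le_sum fun i _ => Nat.mul_le_mul_left _ (Nat.pow_le_pow_left hab i)

theorem opt_of_isPolyBounded {Q : List Bool → List Bool → Bool}
    (hQ : IsProofSystemFor Q ramseyLang) (hb : IsPolyBounded Q) : Opt Q := by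
  intro W hW
  obtain ⟨p, hp⟩ := hb
  refine ⟨p, fun x π hπ => ?_⟩
  have hx : x ∈ ramseyLang := (hW.2 x).2 ⟨π, hπ⟩
  obtain ⟨π₀, hπ₀⟩ := (hQ.2 x).1 hx
  obtain ⟨π', hlen, hacc⟩ := hp x π₀ hπ₀
  exact ⟨π', hlen.trans (eval_mono p (Nat.le_add_right _ _)), hacc⟩

theorem fct_of_opt {Q : List Bool → List Bool → Bool}
    (hQ : IsProofSystemFor Q ramseyLang) (hO : Opt Q) : FCT Q := by
  intro hNP
  obtain ⟨W, hW, hWb⟩ := (hasPolyBoundedProofSystem_iff_mem_NP_holds (L := ramseyLang)).2 hNP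
  exact IsPolyBounded.of_simulates_holds (hO W hW) hWb hQ hW

theorem ramseyNotNP_iff_hard_of_fct {Q : List Bool → List Bool → Bool}
    (hQ : IsProofSystemFor Q ramseyLang) (hF : FCT Q) : RamseyNotNP ↔ Hard Q :=
  ⟨fun hX => hard_of_ramseyNotNP hX hQ, fun hH hNP => hH (hF hNP)⟩

theorem fct_iff_or (Q : List Bool → List Bool → Bool) : FCT Q ↔ RamseyNotNP ∨ IsPolyBounded Q := by
  unfold FCT
  constructor
  · intro h
    by_cases hX : RamseyNotNP
    · exact Or.inl hX
    · exact Or.inr (h (not_not.1 hX))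
  · rintro (hX | hb) hNP
    · exact (hX hNP).elim
    · exact hb

/-! ## Part B — triage certificates -/

/-- C1. The thesis in `FCT` form is verbatim "a lower bound for `Q` implies the crux". -/
theorem fct_iff_hard_imp (Q : List Bool → List Bool → Bool) :
    FCT Q ↔ (Hard Q → RamseyNotNP) := by
  rw [fct_iff_or]
  unfold Hard
  tauto

/-- C1'. Consequently the card's headline `FCT Q → (RamseyNotNP ↔ Hard Q)` needs no hypothesis on
`Q` being a proof system at all beyond `X → Hard Q`: it is `(H → X) → (X → H) → (X ↔ H)`. -/
theorem headline_is_tautology {X H : Prop} (hF : H → X) (hconv : X → H) : X ↔ H :=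
  ⟨hconv, hF⟩

/-- C2. The stub set of the line is the crux plus optimality. -/
theorem stubs_iff_crux_and_opt {Q : List Bool → List Bool → Bool}
    (hQ : IsProofSystemFor Q ramseyLang) :
    (Hard Q ∧ Opt Q) ↔ (RamseyNotNP ∧ Opt Q) :=
  ⟨fun h => ⟨ramseyNotNP_of_hard_opt hQ h.1 h.2, h.2⟩,
   fun h => ⟨hard_of_ramseyNotNP h.1 hQ, h.2⟩⟩

/-- C3. The cut is language-generic (Cook–Reckhow bookkeeping): for ANY language `L`, a proof
system for `L` that is not polynomially bounded but simulates every proof system for `L` witnesses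
`L ∉ NP`. Same three lines as the card's `ramseyNotNP_of_hard_opt`. -/
theorem generic_cut (L : Language Bool) {Q : List Bool → List Bool → Bool}
    (hQ : IsProofSystemFor Q L) (hH : ¬ IsPolyBounded Q)
    (hO : ∀ W, IsProofSystemFor W L → Simulates Q W) : L ∉ NP := by
  intro hNP
  obtain ⟨W, hW, hWb⟩ := (hasPolyBoundedProofSystem_iff_mem_NP_holds (L := L)).2 hNP
  exact hH (IsPolyBounded.of_simulates_holds (hO W hW) hWb hQ hW)

/-- C3'. … and for every `L` and `Q`, `(Hard ∧ Opt) ↔ (L ∉ NP ∧ Opt)`, exactly as for RAMSEY₂. -/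
theorem generic_stubs_iff (L : Language Bool) {Q : List Bool → List Bool → Bool}
    (hQ : IsProofSystemFor Q L) :
    (¬ IsPolyBounded Q ∧ ∀ W, IsProofSystemFor W L → Simulates Q W) ↔
      (L ∉ NP ∧ ∀ W, IsProofSystemFor W L → Simulates Q W) :=
  ⟨fun h => ⟨generic_cut L hQ h.1 h.2, h.2⟩,
   fun h => ⟨fun hb => h.1 ((hasPolyBoundedProofSystem_iff_mem_NP_holds (L := L)).1 ⟨Q, hQ, hb⟩),
     h.2⟩⟩

/-- C4. `Opt Q` splits along X: in the refuter's world (`¬X`) it says exactly "`Q` is p-bounded";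
in the X-world it is the optimality of a hard system. Its content beyond `FCT` (= `Hard → X`) is
"RAMSEY₂ has an optimal proof system, namely `Q`" — an open structural problem, now a stub. -/
theorem opt_iff_split {Q : List Bool → List Bool → Bool} (hQ : IsProofSystemFor Q ramseyLang) :
    Opt Q ↔ ((¬ RamseyNotNP → IsPolyBounded Q) ∧ (RamseyNotNP → Opt Q)) := by
  constructor
  · intro hO
    exact ⟨fun hX => fct_of_opt hQ hO (not_not.1 hX), fun _ => hO⟩
  · rintro ⟨h1, h2⟩
    by_cases hX : RamseyNotNP
    · exact h2 hX
    · exact opt_of_isPolyBounded hQ (h1 hX)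

/-- C5. `Opt Q` for ANY `Q` asserts that RAMSEY₂ HAS an optimal (weakly simulating) proof system —
ideator 4's open question Q2 (NegativeNotes-ideator4-r2 §L2), here the definitional unfolding. -/
theorem opt_gives_optimal_system {Q : List Bool → List Bool → Bool}
    (hQ : IsProofSystemFor Q ramseyLang) (hO : Opt Q) :
    ∃ P, IsProofSystemFor P ramseyLang ∧ ∀ W, IsProofSystemFor W ramseyLang → Simulates P W :=
  ⟨Q, hQ, hO⟩

end Summit.PneNP.PneNP.Cruxes.RamseyNotNP.TriageR2K2
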